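import Mathlib
import HarnessLib
import Literature.MathematicalPhysics.QuantumLattice.HubbardBandSectorCountingToolbox
import Literature.MathematicalPhysics.QuantumLattice.AnisotropicSectors

/-!
# Route `KLProgramme` — crux K1 `H10TwoPointLimit` (stmt-HubbardSuperconductivity-19938):
# the RELATIVE sector count modulo `2πℤ²` with ONE determined leg (input (V) of Paper 1's Theorem 2.1)

Benfatto–Giuliani–Mastropietro 2006 (Ann. Henri Poincaré 7, 809; arXiv:cond-mat/0507686) bound the sector sums of their
tree expansion (Theorem 2.1, (2.83)/(2.89)) with the anisotropic RELATIVE sector counting Lemma A3.1: given one fine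
sector and the coarse sectors of the other `L - 1` legs of a vertex, the number of fine refinements compatible with momentum
conservation `Σ εᵢ kᵢ = 0` in `ℝ²` is `≤ c^L γ^{(h-h')(L-3)/2}` ("two legs determined"). At intermediate filling momentum is
conserved only modulo `2πℤ²`, and that lemma FAILS there (cell gate-hubbard-kl, HOME/prover-p4/COUNTING-NOTE-2.md: at an
umklapp corner `2πG - 3p(θ*) ∈ F_μ` the anchored leg is transversal to a collinear bundle and the `L = 4` count is `≥ c N_c²`).
What Paper 1 (= K1, the theorem at `β ≤ e^{a/|U|}`) uses instead is the bound with ONE determined leg,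
`≤ c_L γ^{(h-h')(L-2)/2}`, uniformly modulo `2πℤ²`: all summed legs but the last are free, and the last leg's fine sector is
fixed up to `O(L)` choices because its momentum is fixed up to `O(L γ^{h'/2})` and `|k| ≥ u_min` on the shell. The resulting
`|h|` per 6-leg vertex (marginal power counting `3/2 - p/4` at `p = 6`) is paid by `c₀ = U₀|h_β|`, exactly like the isotropic
logarithm of Lemma 3.1 (`CountPairsOffset`, item stmt-…-20036) at the endpoints.

This file proves that bound on the landed band-geometry toolbox (`HubbardBandSectorCountingToolbox`: `BandBounds`,
`card_grid_in_box_le`, `band_eq_of_level`, the Lipschitz bounds), in three layers: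

* `cell_of_level_of_angle` — a momentum of the square with `|ε(k) - μ| ≤ η` and polar angle within `α` of `θ₀` (modulo `2π`)
  is within `η/Dt_min + s_max α` of the curve point `p_μ(θ₀)`, coordinatewise (the tree's `cell` with free radial and angular
  tolerances, so that it serves BGM's ANISOTROPIC sectors: `η = e₀ γ^h ≪ α = 3πγ^{h/2}/4`); `anisotropicSector_cell` — the
  instance for the tree's `anisotropicCutoff e₀ μ n ω` (BGM (2.46));
* `lastLeg_count_le` — the number of grid angles `θ_ω = w/2 + ω w` (`N w = 2π`) whose cell contains a momentum within `ρ`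
  of an ARBITRARY target `q ∈ ℝ²` is `≤ 3 (2π√2 (ρ + η/Dt_min + s_max α)/(u_min w) + 1)` — uniform in `q`, hence in the
  umklapp class `G`;
* `relCount_lastLeg_le` — the relative count with one determined leg, in the abstract form Theorem 2.1 consumes: if the other
  legs' admissible momenta (any sets: fine or coarse sectors at any scales, anchored or summed, any signs `εᵢ = ±1`) lie within
  `rᵢ` of points `Pᵢ`, then for every `G ∈ ℤ²` the number of grid sectors of the last leg admitting momenta with
  `Σ εᵢ kᵢ + ε k = 2πG` is `≤ 3 (2π√2 (Σ rᵢ + η/Dt_min + s_max α)/(u_min w) + 1)`; summing over the free legs' index sets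
  `T₂, …, T_{L-1}` (children of coarse sectors, `|Tᵢ| = N_c = γ^{(h-h')/2}`) gives `|T₂|⋯|T_{L-1}|` times that, i.e.
  `c_L γ^{(h-h')(L-2)/2}` — stated for the 4-leg vertex as `relFourLeg_count_le`.

Everything is proved; no definitions, no named facts. References: BGM 2006 §2.5 (2.44)–(2.47), §2.8 (2.83)–(2.96), App. A3
Lemma A3.1 [cite: BenfattoGiulianiMastropietro2006]; BGM 2003 (Ann. Henri Poincaré 4, 137) Lemma 3.1 and §7.4
[cite: BenfattoGiulianiMastropietro2003]; HOME/prover-p4/COUNTING-NOTE-2.md (why (L-2)/2 and not (L-3)/2 modulo 2πℤ²).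
-/

noncomputable section

namespace Summit.HubbardSuperconductivity.HubbardSuperconductivity.Theorems.RelativeSectorCount

set_option linter.dupNamespace false -- summit = problem name (single-conjunct summit), D-0017

open Classical
open Real Set
open Literature.MathematicalPhysics.QuantumLattice Literature.MathematicalPhysics.QuantumLattice.BandSectorCounting

/-- `momToComplex k` is the complex number `⟨k₀, k₁⟩`. [folklore] -/
theorem momToComplex_eq_mk (k : Fin 2 → ℝ) : momToComplex k = (⟨k 0, k 1⟩ : ℂ) :=
  Complex.ext (by simp) (by simp)

section Cell

variable {a b : ℝ} (B : BandBounds a b) {μ : ℝ} (hμ : μ ∈ Icc a b)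
include B hμ

/-- **Cell geometry with free tolerances** (BGM 2003 Lemmas 7.2–7.3 on the band curve): a momentum `k` of the closed
square with `|ε(k) - μ| ≤ η` (`μ ± η` in the level range) whose polar angle is within `α` of `θ₀` modulo `2π` is within
`η/Dt_min + s_max α` of the curve point `p_μ(θ₀)`, coordinatewise. For BGM's anisotropic sectors `η = e₀γ^h` (radial) and
`α = 3πγ^{h/2}/4` (angular). [cite: BenfattoGiulianiMastropietro2003, Lemma 7.3] -/
theorem cell_of_level_of_angle {k : Fin 2 → ℝ} {η α θ₀ : ℝ} {m : ℤ} (hk : ∀ i, |k i| ≤ π)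
    (hshell : |sqDispersion k - μ| ≤ η) (hlo : a ≤ μ - η) (hhi : μ + η ≤ b)
    (hang : |Complex.arg (⟨k 0, k 1⟩ : ℂ) + m * (2 * π) - θ₀| ≤ α) :
    |k 0 - bandX μ θ₀| ≤ η / B.Dtmin + B.smax * α ∧ |k 1 - bandY μ θ₀| ≤ η / B.Dtmin + B.smax * α := by
  obtain ⟨h1, h2⟩ := B.level hμ
  set ν := sqDispersion k with hν
  have hνeq : eps2 (k 0) (k 1) = ν := by simp [hν, sqDispersion, eps2]
  have hνmem : ν ∈ Icc a b := by
    have := abs_le.1 hshell; constructor <;> linarith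
  obtain ⟨hν₁, hν₂⟩ := B.level hνmem
  obtain ⟨hx, hy⟩ := band_eq_of_level hν₁ hν₂ (hk 0) (hk 1) hνeq
  set φ := Complex.arg (⟨k 0, k 1⟩ : ℂ) with hφ
  -- radial deviation
  have hrad := abs_bandFermiRadius_level_sub_le B hνmem hμ φ
  have hradX : |bandX ν φ - bandX μ φ| ≤ η / B.Dtmin := by
    calc |bandX ν φ - bandX μ φ| = |bandFermiRadius ν φ - bandFermiRadius μ φ| * |Real.cos φ| := by
          rw [bandX, bandX, ← sub_mul, abs_mul]
      _ ≤ |bandFermiRadius ν φ - bandFermiRadius μ φ| :=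
          mul_le_of_le_one_right (abs_nonneg _) (Real.abs_cos_le_one φ)
      _ ≤ |ν - μ| / B.Dtmin := hrad
      _ ≤ η / B.Dtmin := div_le_div_of_nonneg_right hshell B.Dtmin_pos.le
  have hradY : |bandY ν φ - bandY μ φ| ≤ η / B.Dtmin := by
    calc |bandY ν φ - bandY μ φ| = |bandFermiRadius ν φ - bandFermiRadius μ φ| * |Real.sin φ| := by
          rw [bandY, bandY, ← sub_mul, abs_mul]
      _ ≤ |bandFermiRadius ν φ - bandFermiRadius μ φ| :=
          mul_le_of_le_one_right (abs_nonneg _) (Real.abs_sin_le_one φ)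
      _ ≤ |ν - μ| / B.Dtmin := hrad
      _ ≤ η / B.Dtmin := div_le_div_of_nonneg_right hshell B.Dtmin_pos.le
  -- angular deviation (after shifting `φ` by `2πm`)
  have hper := band_add_int_mul_two_pi h1 h2 φ m
  have hangX : |bandX μ φ - bandX μ θ₀| ≤ B.smax * α := by
    rw [← hper.1]
    exact (abs_bandX_sub_le B hμ _ _).trans (mul_le_mul_of_nonneg_left hang B.smax_pos.le)
  have hangY : |bandY μ φ - bandY μ θ₀| ≤ B.smax * α := by
    rw [← hper.2.1]
    exact (abs_bandY_sub_le B hμ _ _).trans (mul_le_mul_of_nonneg_left hang B.smax_pos.le)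
  constructor
  · calc |k 0 - bandX μ θ₀| = |(bandX ν φ - bandX μ φ) + (bandX μ φ - bandX μ θ₀)| := by rw [hx]; ring_nf
      _ ≤ |bandX ν φ - bandX μ φ| + |bandX μ φ - bandX μ θ₀| := abs_add_le _ _
      _ ≤ η / B.Dtmin + B.smax * α := add_le_add hradX hangX
  · calc |k 1 - bandY μ θ₀| = |(bandY ν φ - bandY μ φ) + (bandY μ φ - bandY μ θ₀)| := by rw [hy]; ring_nf
      _ ≤ |bandY ν φ - bandY μ φ| + |bandY μ φ - bandY μ θ₀| := abs_add_le _ _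
      _ ≤ η / B.Dtmin + B.smax * α := add_le_add hradY hangY

/-- **BGM's anisotropic sectors are cells**: if `F_{h,ω}(k₀, k⃗) ≠ 0` (`anisotropicCutoff e₀ μ n ω`, BGM 2006 (2.46),
`h = -n`) and `k⃗` lies in the closed square, then `k⃗` is within `e₀ 4^{-n}/Dt_min + s_max · (3 w_n/4)` of the curve point at
the sector centre `θ_{h,ω} = (ω + ½) w_n`, coordinatewise (`w_n = π/2ⁿ = πγ^{h/2}`), provided `μ ± e₀4^{-n}` lies in the level
range. [cite: BenfattoGiulianiMastropietro2006, §2.5 (2.44)–(2.47)] -/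
theorem anisotropicSector_cell {e₀ : ℝ} (he : 0 < e₀) {n : ℕ} {ω : ℤ} {p : ℝ × (Fin 2 → ℝ)}
    (hF : anisotropicCutoff e₀ μ n ω p ≠ 0) (hk : ∀ i, |p.2 i| ≤ π)
    (hlo : a ≤ μ - e₀ * (4 : ℝ) ^ (-(n : ℤ))) (hhi : μ + e₀ * (4 : ℝ) ^ (-(n : ℤ)) ≤ b) :
    |p.2 0 - bandX μ (((ω : ℝ) + 1 / 2) * sectorWidth n)| ≤
        e₀ * (4 : ℝ) ^ (-(n : ℤ)) / B.Dtmin + B.smax * (3 * sectorWidth n / 4) ∧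
      |p.2 1 - bandY μ (((ω : ℝ) + 1 / 2) * sectorWidth n)| ≤
        e₀ * (4 : ℝ) ^ (-(n : ℤ)) / B.Dtmin + B.smax * (3 * sectorWidth n / 4) := by
  -- radial: `|ε - μ| ≤ √(k₀² + (ε - μ)²) < e₀ 4^{-n}`
  have hsc := anisotropicCutoff_ne_zero_scale he hF
  have hshell : |sqDispersion p.2 - μ| ≤ e₀ * (4 : ℝ) ^ (-(n : ℤ)) := by
    have h1 : |sqDispersion p.2 - μ| ≤ Real.sqrt (p.1 ^ 2 + (sqDispersion p.2 - μ) ^ 2) := by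
      rw [← Real.sqrt_sq_eq_abs]
      exact Real.sqrt_le_sqrt (by nlinarith [sq_nonneg p.1])
    exact h1.trans hsc.2.le
  -- angular: `|θ(k⃗) - θ_{h,ω} - 2πj| < 3w/4`
  obtain ⟨j, hj⟩ := anisotropicCutoff_ne_zero_angle hF
  have hang : |Complex.arg (⟨p.2 0, p.2 1⟩ : ℂ) + (-j : ℤ) * (2 * π) - ((ω : ℝ) + 1 / 2) * sectorWidth n| ≤
      3 * sectorWidth n / 4 := by
    rw [← momToComplex_eq_mk]
    have : Complex.arg (momToComplex p.2) + ((-j : ℤ) : ℝ) * (2 * π) - ((ω : ℝ) + 1 / 2) * sectorWidth n =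
        polarAngle p.2 - ((ω : ℝ) + 1 / 2) * sectorWidth n - 2 * π * j := by
      rw [polarAngle]; push_cast; ring
    rw [this]; exact hj.le
  exact cell_of_level_of_angle B hμ hk hshell hlo hhi hang

end Cell

section Count

variable {a b : ℝ} (B : BandBounds a b) {μ : ℝ} (hμ : μ ∈ Icc a b)
include B hμ

/-- **The last leg is determined (up to `O(1)` sectors) by an arbitrary target.** For every target `(qx, qy) ∈ ℝ²`
and radius `ρ ≥ 0`, the number of grid angles `θ_ω = w/2 + ω w`, `ω < N`, `N w = 2π`, whose cell (momenta of the closed square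
with `|ε - μ| ≤ η` and polar angle within `α` of `θ_ω` mod `2π`) contains a momentum within `ρ` of the target, coordinatewise,
is `≤ 3 (2π √2 (ρ + η/Dt_min + s_max α)/(u_min w) + 1)` — uniformly in the target, hence in the umklapp class. This is
the «one determined leg» of the relative count `c_L γ^{(h-h')(L-2)/2}` (HOME/prover-p4/COUNTING-NOTE-2.md §5(b′)).
[cite: BenfattoGiulianiMastropietro2006, §2.8 (2.89), App. A3] -/
theorem lastLeg_count_le {N : ℕ} {w : ℝ} (hw : 0 < w) (hN : (N : ℝ) * w = 2 * π)
    {η α ρ : ℝ} (hη : 0 ≤ η) (hα : 0 ≤ α) (hρ : 0 ≤ ρ) (hlo : a ≤ μ - η) (hhi : μ + η ≤ b) (qx qy : ℝ) :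
    ((((Finset.range N).filter fun ω : ℕ => ∃ k : Fin 2 → ℝ, (∀ i, |k i| ≤ π) ∧ |sqDispersion k - μ| ≤ η ∧
        (∃ m : ℤ, |Complex.arg (⟨k 0, k 1⟩ : ℂ) + m * (2 * π) - (w / 2 + ω * w)| ≤ α) ∧
        |k 0 - qx| ≤ ρ ∧ |k 1 - qy| ≤ ρ).card : ℝ)) ≤
      3 * (2 * (π * (Real.sqrt 2 * (ρ + (η / B.Dtmin + B.smax * α)) / B.umin)) / w + 1) := by
  have hr : 0 ≤ ρ + (η / B.Dtmin + B.smax * α) := by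
    have := B.Dtmin_pos; have := B.smax_pos; positivity
  have hsub : ((Finset.range N).filter fun ω : ℕ => ∃ k : Fin 2 → ℝ, (∀ i, |k i| ≤ π) ∧ |sqDispersion k - μ| ≤ η ∧
        (∃ m : ℤ, |Complex.arg (⟨k 0, k 1⟩ : ℂ) + m * (2 * π) - (w / 2 + ω * w)| ≤ α) ∧
        |k 0 - qx| ≤ ρ ∧ |k 1 - qy| ≤ ρ) ⊆
      ((Finset.range N).filter fun ω : ℕ =>
        |bandX μ (w / 2 + ω * w) - qx| ≤ ρ + (η / B.Dtmin + B.smax * α) ∧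
          |bandY μ (w / 2 + ω * w) - qy| ≤ ρ + (η / B.Dtmin + B.smax * α)) := by
    intro ω hω
    rw [Finset.mem_filter] at hω ⊢
    refine ⟨hω.1, ?_⟩
    obtain ⟨k, hk, hshell, ⟨m, hang⟩, hx, hy⟩ := hω.2
    obtain ⟨hcx, hcy⟩ := cell_of_level_of_angle B hμ hk hshell hlo hhi hang
    constructor
    · calc |bandX μ (w / 2 + ω * w) - qx| = |(k 0 - qx) - (k 0 - bandX μ (w / 2 + ω * w))| := by ring_nf
        _ ≤ |k 0 - qx| + |k 0 - bandX μ (w / 2 + ω * w)| := abs_sub _ _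
        _ ≤ ρ + (η / B.Dtmin + B.smax * α) := add_le_add hx hcx
    · calc |bandY μ (w / 2 + ω * w) - qy| = |(k 1 - qy) - (k 1 - bandY μ (w / 2 + ω * w))| := by ring_nf
        _ ≤ |k 1 - qy| + |k 1 - bandY μ (w / 2 + ω * w)| := abs_sub _ _
        _ ≤ ρ + (η / B.Dtmin + B.smax * α) := add_le_add hy hcy
  calc _ ≤ ((((Finset.range N).filter fun ω : ℕ =>
        |bandX μ (w / 2 + ω * w) - qx| ≤ ρ + (η / B.Dtmin + B.smax * α) ∧
          |bandY μ (w / 2 + ω * w) - qy| ≤ ρ + (η / B.Dtmin + B.smax * α)).card : ℝ)) := by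
        exact_mod_cast Finset.card_le_card hsub
    _ ≤ _ := card_grid_in_box_le B hμ hw hN hr

/-- **The relative count with one determined leg, abstract form** (input (V) of Paper 1's Theorem 2.1). Let the momenta of
the «other» legs of a vertex range over arbitrary sets `A i` (`i < M`: fine or coarse sectors at any scales, anchored or already
summed) whose members are within `r i` of points `P i`, coordinatewise, with signs `s i = ±1`; let the last leg carry sign
`t = ±1` and range over the cells of the grid angles `θ_ω = w/2 + ω w`. Then for every `G ∈ ℤ²` the number of `ω < N` for which
momenta `kᵢ ∈ A i` and `k ∈ cell(θ_ω)` exist with `Σᵢ sᵢ kᵢ + t k = 2πG` is `≤ 3 (2π √2 (Σᵢ rᵢ + η/Dt_min + s_max α)/(u_min w) + 1)`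
— independent of `G`, of the `P i` and of how many legs there are. [cite: BenfattoGiulianiMastropietro2006, §2.8 (2.83)–(2.96)] -/
theorem relCount_lastLeg_le {N : ℕ} {w : ℝ} (hw : 0 < w) (hN : (N : ℝ) * w = 2 * π)
    {η α : ℝ} (hη : 0 ≤ η) (hα : 0 ≤ α) (hlo : a ≤ μ - η) (hhi : μ + η ≤ b)
    {M : ℕ} (A : Fin M → Set (Fin 2 → ℝ)) (P : Fin M → Fin 2 → ℝ) (r : Fin M → ℝ) (hr : ∀ i, 0 ≤ r i)
    (hA : ∀ i, ∀ k ∈ A i, ∀ c : Fin 2, |k c - P i c| ≤ r i)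
    (s : Fin M → ℝ) (hs : ∀ i, s i = 1 ∨ s i = -1) (t : ℝ) (ht : t = 1 ∨ t = -1) (G : Fin 2 → ℤ) :
    ((((Finset.range N).filter fun ω : ℕ => ∃ ks : Fin M → Fin 2 → ℝ, ∃ k : Fin 2 → ℝ,
        (∀ i, ks i ∈ A i) ∧ (∀ c, |k c| ≤ π) ∧ |sqDispersion k - μ| ≤ η ∧
        (∃ m : ℤ, |Complex.arg (⟨k 0, k 1⟩ : ℂ) + m * (2 * π) - (w / 2 + ω * w)| ≤ α) ∧
        ∀ c : Fin 2, (∑ i, s i * ks i c) + t * k c = 2 * π * G c).card : ℝ)) ≤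
      3 * (2 * (π * (Real.sqrt 2 * ((∑ i, r i) + (η / B.Dtmin + B.smax * α)) / B.umin)) / w + 1) := by
  -- the target: `q = t (2πG - Σ sᵢ Pᵢ)`
  set q : Fin 2 → ℝ := fun c => t * (2 * π * G c - ∑ i, s i * P i c) with hq
  have hρ : 0 ≤ ∑ i, r i := Finset.sum_nonneg fun i _ => hr i
  have ht2 : t * t = 1 := by rcases ht with h | h <;> simp [h]
  have htabs : |t| = 1 := by rcases ht with h | h <;> simp [h]
  have hsub : ((Finset.range N).filter fun ω : ℕ => ∃ ks : Fin M → Fin 2 → ℝ, ∃ k : Fin 2 → ℝ,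
        (∀ i, ks i ∈ A i) ∧ (∀ c, |k c| ≤ π) ∧ |sqDispersion k - μ| ≤ η ∧
        (∃ m : ℤ, |Complex.arg (⟨k 0, k 1⟩ : ℂ) + m * (2 * π) - (w / 2 + ω * w)| ≤ α) ∧
        ∀ c : Fin 2, (∑ i, s i * ks i c) + t * k c = 2 * π * G c) ⊆
      ((Finset.range N).filter fun ω : ℕ => ∃ k : Fin 2 → ℝ, (∀ i, |k i| ≤ π) ∧ |sqDispersion k - μ| ≤ η ∧
        (∃ m : ℤ, |Complex.arg (⟨k 0, k 1⟩ : ℂ) + m * (2 * π) - (w / 2 + ω * w)| ≤ α) ∧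
        |k 0 - q 0| ≤ (∑ i, r i) ∧ |k 1 - q 1| ≤ ∑ i, r i) := by
    intro ω hω
    rw [Finset.mem_filter] at hω ⊢
    refine ⟨hω.1, ?_⟩
    obtain ⟨ks, k, hks, hk, hshell, hang, hsum⟩ := hω.2
    -- `t² = 1`, so `k = t (2πG - Σ sᵢ ksᵢ)` and `|k - q| ≤ Σ |sᵢ| rᵢ = Σ rᵢ`
    have key : ∀ c : Fin 2, |k c - q c| ≤ ∑ i, r i := by
      intro c
      have hkc : k c = t * (2 * π * G c - ∑ i, s i * ks i c) := by
        have h := congrArg (fun x => t * x) (hsum c)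
        simp only [mul_add, ← mul_assoc, ht2, one_mul] at h
        linarith
      have hdiff : k c - q c = t * ∑ i, s i * (P i c - ks i c) := by
        rw [hkc, hq]
        simp only [mul_sub, Finset.mul_sum, Finset.sum_sub_distrib]
        ring
      rw [hdiff, abs_mul, htabs, one_mul]
      refine (Finset.abs_sum_le_sum_abs _ _).trans (Finset.sum_le_sum fun i _ => ?_)
      have hsabs : |s i| = 1 := by rcases hs i with h | h <;> simp [h]
      rw [abs_mul, hsabs, one_mul, abs_sub_comm]
      exact hA i (ks i) (hks i) c
    exact ⟨k, hk, hshell, hang, key 0, key 1⟩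
  calc _ ≤ ((((Finset.range N).filter fun ω : ℕ => ∃ k : Fin 2 → ℝ, (∀ i, |k i| ≤ π) ∧ |sqDispersion k - μ| ≤ η ∧
        (∃ m : ℤ, |Complex.arg (⟨k 0, k 1⟩ : ℂ) + m * (2 * π) - (w / 2 + ω * w)| ≤ α) ∧
        |k 0 - q 0| ≤ (∑ i, r i) ∧ |k 1 - q 1| ≤ ∑ i, r i).card : ℝ)) := by
        exact_mod_cast Finset.card_le_card hsub
    _ ≤ _ := lastLeg_count_le B hμ hw hN hη hα hρ hlo hhi (q 0) (q 1)

/-- **The relative 4-leg count modulo `2πℤ²` with one determined leg** (the `L = 4` instance of `c_L γ^{(h-h')(L-2)/2}`;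
COUNTING-NOTE-2 Prop. N shows it is SHARP at umklapp corners, where BGM's `c γ^{(h-h')/2}` fails). Leg 1 is anchored in the
cell of `θ₁`; legs 2 and 3 run over ARBITRARY finite index sets `T₂, T₃` (the children of their coarse sectors) with arbitrary
centres `c₂ ω₂, c₃ ω₃`; leg 4 runs over the grid `θ_ω = w/2 + ω w`, `ω < N`, `N w = 2π`; all cells have radial tolerance `η`
and angular tolerance `α`; signs `sᵢ, t = ±1`; `G ∈ ℤ²` arbitrary. The number of admissible triples `(ω₂, ω₃, ω₄)` is
`≤ |T₂| |T₃| · 3 (2π √2 · 4 (η/Dt_min + s_max α)/(u_min w) + 1)`. [cite: BenfattoGiulianiMastropietro2006, App. A3 Lemma A3.1] -/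
theorem relFourLeg_count_le {N : ℕ} {w : ℝ} (hw : 0 < w) (hN : (N : ℝ) * w = 2 * π)
    {η α : ℝ} (hη : 0 ≤ η) (hα : 0 ≤ α) (hlo : a ≤ μ - η) (hhi : μ + η ≤ b)
    (T₂ T₃ : Finset ℕ) (θ₁ : ℝ) (c₂ c₃ : ℕ → ℝ)
    (s₁ s₂ s₃ t : ℝ) (hs₁ : s₁ = 1 ∨ s₁ = -1) (hs₂ : s₂ = 1 ∨ s₂ = -1) (hs₃ : s₃ = 1 ∨ s₃ = -1)
    (ht : t = 1 ∨ t = -1) (G : Fin 2 → ℤ) :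
    (((((T₂ ×ˢ T₃) ×ˢ Finset.range N).filter fun x : (ℕ × ℕ) × ℕ =>
        ∃ k₁ k₂ k₃ k₄ : Fin 2 → ℝ,
          ((∀ c, |k₁ c| ≤ π) ∧ |sqDispersion k₁ - μ| ≤ η ∧
            ∃ m : ℤ, |Complex.arg (⟨k₁ 0, k₁ 1⟩ : ℂ) + m * (2 * π) - θ₁| ≤ α) ∧
          ((∀ c, |k₂ c| ≤ π) ∧ |sqDispersion k₂ - μ| ≤ η ∧
            ∃ m : ℤ, |Complex.arg (⟨k₂ 0, k₂ 1⟩ : ℂ) + m * (2 * π) - c₂ x.1.1| ≤ α) ∧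
          ((∀ c, |k₃ c| ≤ π) ∧ |sqDispersion k₃ - μ| ≤ η ∧
            ∃ m : ℤ, |Complex.arg (⟨k₃ 0, k₃ 1⟩ : ℂ) + m * (2 * π) - c₃ x.1.2| ≤ α) ∧
          ((∀ c, |k₄ c| ≤ π) ∧ |sqDispersion k₄ - μ| ≤ η ∧
            ∃ m : ℤ, |Complex.arg (⟨k₄ 0, k₄ 1⟩ : ℂ) + m * (2 * π) - (w / 2 + x.2 * w)| ≤ α) ∧
          ∀ c : Fin 2, s₁ * k₁ c + s₂ * k₂ c + s₃ * k₃ c + t * k₄ c = 2 * π * G c).card : ℝ)) ≤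
      T₂.card * T₃.card *
        (3 * (2 * (π * (Real.sqrt 2 * (3 * (η / B.Dtmin + B.smax * α) + (η / B.Dtmin + B.smax * α)) / B.umin)) / w + 1)) := by
  set ρc : ℝ := η / B.Dtmin + B.smax * α with hρc
  have hρc0 : 0 ≤ ρc := by have := B.Dtmin_pos; have := B.smax_pos; positivity
  -- the cell predicate and its radius
  set Cell : ℝ → (Fin 2 → ℝ) → Prop := fun θ k => (∀ c, |k c| ≤ π) ∧ |sqDispersion k - μ| ≤ η ∧
    ∃ m : ℤ, |Complex.arg (⟨k 0, k 1⟩ : ℂ) + m * (2 * π) - θ| ≤ α with hCell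
  have hcellR : ∀ θ k, Cell θ k → ∀ c : Fin 2, |k c - ![bandX μ θ, bandY μ θ] c| ≤ ρc := by
    intro θ k hk c
    obtain ⟨hk1, hk2, m, hk3⟩ := hk
    obtain ⟨hx, hy⟩ := cell_of_level_of_angle B hμ hk1 hk2 hlo hhi hk3
    fin_cases c
    · simpa using hx
    · simpa using hy
  set S := ((T₂ ×ˢ T₃) ×ˢ Finset.range N).filter fun x : (ℕ × ℕ) × ℕ =>
        ∃ k₁ k₂ k₃ k₄ : Fin 2 → ℝ, Cell θ₁ k₁ ∧ Cell (c₂ x.1.1) k₂ ∧ Cell (c₃ x.1.2) k₃ ∧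
          Cell (w / 2 + x.2 * w) k₄ ∧ ∀ c : Fin 2, s₁ * k₁ c + s₂ * k₂ c + s₃ * k₃ c + t * k₄ c = 2 * π * G c with hS
  set bnd : ℝ := 3 * (2 * (π * (Real.sqrt 2 * (3 * ρc + ρc) / B.umin)) / w + 1) with hbnd
  -- the fibre over `(ω₂, ω₃)`
  set Fib : ℕ × ℕ → Finset ℕ := fun x => (Finset.range N).filter fun ω : ℕ =>
      ∃ k₁ k₂ k₃ k₄ : Fin 2 → ℝ, Cell θ₁ k₁ ∧ Cell (c₂ x.1) k₂ ∧ Cell (c₃ x.2) k₃ ∧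
        Cell (w / 2 + ω * w) k₄ ∧ ∀ c : Fin 2, s₁ * k₁ c + s₂ * k₂ c + s₃ * k₃ c + t * k₄ c = 2 * π * G c with hFib
  -- (1) fibre decomposition of the count
  have hmaps : Set.MapsTo Prod.fst (S : Set ((ℕ × ℕ) × ℕ)) ((T₂ ×ˢ T₃ : Finset (ℕ × ℕ)) : Set (ℕ × ℕ)) := by
    intro z hz
    rw [Finset.mem_coe, hS, Finset.mem_filter, Finset.mem_product] at hz
    rw [Finset.mem_coe]
    exact hz.1.1
  have hdec := Finset.card_eq_sum_card_fiberwise hmaps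
  have hfib : ∀ x ∈ T₂ ×ˢ T₃, ((S.filter fun z => z.1 = x).card : ℝ) ≤ ((Fib x).card : ℝ) := by
    intro x _
    exact_mod_cast Finset.card_le_card_of_injOn Prod.snd
      (fun z hz => by
        rw [Finset.mem_coe, Finset.mem_filter, hS, Finset.mem_filter, Finset.mem_product] at hz
        obtain ⟨⟨⟨_, hz2⟩, hP⟩, hzx⟩ := hz
        rw [Finset.mem_coe, hFib, Finset.mem_filter]
        rw [← hzx]
        exact ⟨hz2, hP⟩)
      (fun z hz z' hz' h => by
        rw [Finset.mem_coe, Finset.mem_filter] at hz hz'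
        exact Prod.ext (hz.2.trans hz'.2.symm) h)
  -- (2) each fibre is a last-leg count against the target `t (2πG - s₁p(θ₁) - s₂p(c₂ω₂) - s₃p(c₃ω₃))`
  have hfib' : ∀ x : ℕ × ℕ, ((Fib x).card : ℝ) ≤ bnd := by
    intro x
    set A : Fin 3 → Set (Fin 2 → ℝ) := ![{k | Cell θ₁ k}, {k | Cell (c₂ x.1) k}, {k | Cell (c₃ x.2) k}] with hA
    set P : Fin 3 → Fin 2 → ℝ := ![![bandX μ θ₁, bandY μ θ₁], ![bandX μ (c₂ x.1), bandY μ (c₂ x.1)],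
      ![bandX μ (c₃ x.2), bandY μ (c₃ x.2)]] with hP
    set sg : Fin 3 → ℝ := ![s₁, s₂, s₃] with hsg
    have hsg' : ∀ i, sg i = 1 ∨ sg i = -1 := by
      intro i; fin_cases i
      · simpa [hsg] using hs₁
      · simpa [hsg] using hs₂
      · simpa [hsg] using hs₃
    have hAP : ∀ i, ∀ k ∈ A i, ∀ c : Fin 2, |k c - P i c| ≤ (fun _ : Fin 3 => ρc) i := by
      intro i k hk c
      fin_cases i
      · exact hcellR θ₁ k (by simpa [hA] using hk) c
      · exact hcellR (c₂ x.1) k (by simpa [hA] using hk) c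
      · exact hcellR (c₃ x.2) k (by simpa [hA] using hk) c
    have hmain := relCount_lastLeg_le B hμ hw hN hη hα hlo hhi A P (fun _ => ρc) (fun _ => hρc0) hAP sg hsg' t ht G
    have hsum3 : (∑ _i : Fin 3, ρc) = 3 * ρc := by simp [Finset.sum_const]
    rw [hsum3] at hmain
    refine le_trans ?_ hmain
    have hsub : Fib x ⊆ (Finset.range N).filter fun ω : ℕ => ∃ ks : Fin 3 → Fin 2 → ℝ, ∃ k : Fin 2 → ℝ,
        (∀ i, ks i ∈ A i) ∧ (∀ c, |k c| ≤ π) ∧ |sqDispersion k - μ| ≤ η ∧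
        (∃ m : ℤ, |Complex.arg (⟨k 0, k 1⟩ : ℂ) + m * (2 * π) - (w / 2 + ω * w)| ≤ α) ∧
        ∀ c : Fin 2, (∑ i, sg i * ks i c) + t * k c = 2 * π * G c := by
      intro ω hω
      rw [hFib, Finset.mem_filter] at hω
      rw [Finset.mem_filter]
      refine ⟨hω.1, ?_⟩
      obtain ⟨k₁, k₂, k₃, k₄, h1, h2, h3, h4, hsum⟩ := hω.2
      refine ⟨![k₁, k₂, k₃], k₄, ?_, h4.1, h4.2.1, h4.2.2, ?_⟩
      · intro i; fin_cases i
        · simpa [hA] using h1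
        · simpa [hA] using h2
        · simpa [hA] using h3
      · intro c
        rw [Fin.sum_univ_three]
        simpa [hsg] using hsum c
    exact_mod_cast Finset.card_le_card hsub
  -- (3) assemble
  calc (S.card : ℝ) = ∑ x ∈ T₂ ×ˢ T₃, ((S.filter fun z => z.1 = x).card : ℝ) := by
        rw [hdec]; push_cast; rfl
    _ ≤ ∑ x ∈ T₂ ×ˢ T₃, bnd := Finset.sum_le_sum fun x hx => (hfib x hx).trans (hfib' x)
    _ = T₂.card * T₃.card * bnd := by
        rw [Finset.sum_const, Finset.card_product, nsmul_eq_mul]; push_cast; ring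


end Count

end Summit.HubbardSuperconductivity.HubbardSuperconductivity.Theorems.RelativeSectorCount
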